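import Mathlib.Analysis.SpecialFunctions.Log.Base
import Literature.MathematicalPhysics.QuantumFieldTheory.Balaban1983to89.T4TermwiseClosure

/-!
# Spine/NE7/SpineRemainderRate — the RATE OF APPROACH that the nine-estimate spine's OWN remainder shape predicts:
# `δ_K ≤ D·(K+1)^m·q^K` ⟹ `|genFun Z K t − genFunLim Z t| ≤ 2·vol·D·(K+1)^m·q^K·Σ_j (j+1)^m q^j`, composed with
# `T4CauchySum.delta_le` (`m = c+1`, `q = max(θ,ρ)`), and «geometric in `K` = a power law in the lattice spacing `a = L^{−K}`»

Cell `pub-balaban-gaps` (YM blitz Y1, track G2, seat `ne7`, generation 13); text of record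
`run/shared/lean/pub/pub-balaban-gaps/ne/NE7.md` (v13.x, census R71's DICTIONARY and the v12.2 precision sentence, which this
file turns into theorems BY NAME).  45th `Spine/NE7/` file; 0 `def`, 0 sorry; [folklore] real analysis + [bookkeeping].

WHY.  The tree's tail faces for node U5 ∕ U0 (`T4TermwiseClosure.abs_genFun_sub_lim_le_of_le` — any summable majorant;
`…_of_geometric` — `D·ρ^K`; `…_of_succ_mul_geometric` — `D·(K+1)·q^K`) do not cover the shape the spine ACTUALLY produces
for its transported total: `T4CauchySum.delta_le` gives `delta E ρ inj K ≤ E·C·(K+1)^{c+1}·max(θ,ρ)^K` under an injected rate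
`InjectedRate C c θ inj` (`θ` = the η-rate ratio of rows NE2∕NE3∕NE5; `ρ = L^{−β}`, `β < 1`, the (2.43) transport of
[Balaban1988Convergent]).  §1 proves the elementary tail comparison `Σ_{j≥0} (K+j+1)^m q^{K+j} ≤ (K+1)^m q^K · Σ_{j≥0} (j+1)^m q^j`
(from `K+j+1 ≤ (K+1)(j+1)`), §2 the rate face for `δ_K ≤ D·(K+1)^m·q^K` and its composition with `delta_le`
(`abs_genFun_sub_lim_le_of_injectedRate`: the generating functions approach their limit at the rate `(K+1)^{c+1}·max(θ,ρ)^K`,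
uniformly on `|t| ≤ l₀`, with an explicit constant), §3 the dictionary line «a geometric factor `r^K` IS the power `a_K^{β′}` of
the lattice spacing `a_K = (L^K)⁻¹` with `β′ = log_L(1∕r)`», and `0 < β′ < 1` exactly when `L⁻¹ < r < 1` — the kernel form of
census R71's sentence «the spine predicts only a power law `a^{β′}`, `β′ < 1`, up to logarithms» (there `r = max(θ,ρ) ≥ ρ =
L^{−β} > L⁻¹`).  Nothing here is specific to Bałaban's objects: these are faces over the HYPOTHESIS `MatchingModConstants`.

HONEST FRAMING.  [folklore] real analysis and [bookkeeping] over named tree shapes; NO estimate of Bałaban's is asserted; NE7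
(`MatchingModConstants ∧ Summable δ` for the dressed partition functions of two runs) is NOT proved and NOT in print; spine
0∕9; one fixed finite T⁴ — NOT ℝ⁴, NOT infinite volume, NOT a mass gap, NOT Clay.  No classification word moves (R10).
-/

noncomputable section

open Finset
open scoped BigOperators

namespace Summit.QuantumFields.BalabanUV.T4Continuum.Spine.NE7

open Literature.MathematicalPhysics.QuantumFieldTheory.Balaban1983to89
open Literature.MathematicalPhysics.QuantumFieldTheory.Balaban1983to89.T4CauchySum
open Literature.MathematicalPhysics.QuantumFieldTheory.Balaban1983to89.T4TermwiseClosure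

/-! ## §1 The tail of «polynomial × geometric» -/

/-- Termwise comparison behind the tail bound: `(K+j+1)^m·q^{K+j} ≤ ((K+1)^m·q^K)·((j+1)^m·q^j)` for `q ≥ 0`, from
`K + j + 1 ≤ (K+1)·(j+1)`. [folklore] -/
theorem succ_pow_mul_geometric_add_le {q : ℝ} (hq0 : 0 ≤ q) (m K j : ℕ) :
    (((K + j : ℕ) : ℝ) + 1) ^ m * q ^ (K + j) ≤ (((K : ℝ) + 1) ^ m * q ^ K) * ((((j : ℕ) : ℝ) + 1) ^ m * q ^ j) := by
  have hK : (0 : ℝ) ≤ K := Nat.cast_nonneg K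
  have hj : (0 : ℝ) ≤ j := Nat.cast_nonneg j
  have h1 : (((K + j : ℕ) : ℝ) + 1) ≤ ((K : ℝ) + 1) * ((j : ℝ) + 1) := by
    push_cast
    nlinarith [mul_nonneg hK hj]
  have h0 : 0 ≤ (((K + j : ℕ) : ℝ) + 1) := by positivity
  calc (((K + j : ℕ) : ℝ) + 1) ^ m * q ^ (K + j)
      ≤ (((K : ℝ) + 1) * ((j : ℝ) + 1)) ^ m * q ^ (K + j) :=
        mul_le_mul_of_nonneg_right (pow_le_pow_left₀ h0 h1 m) (pow_nonneg hq0 _)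
    _ = (((K : ℝ) + 1) ^ m * q ^ K) * ((((j : ℕ) : ℝ) + 1) ^ m * q ^ j) := by
        rw [mul_pow, pow_add]; ring

/-- **TAIL BOUND**: `Σ_{j≥0} (K+j+1)^m·q^{K+j} ≤ (K+1)^m·q^K · Σ_{j≥0} (j+1)^m·q^j` for `0 ≤ q < 1` (both series converge by
`T4CauchySum.summable_succ_pow_mul_geometric`). [folklore] -/
theorem tsum_tail_succ_pow_mul_geometric_le {q : ℝ} (hq0 : 0 ≤ q) (hq1 : q < 1) (m K : ℕ) :
    ∑' j : ℕ, (((K + j : ℕ) : ℝ) + 1) ^ m * q ^ (K + j)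
      ≤ (((K : ℝ) + 1) ^ m * q ^ K) * ∑' j : ℕ, ((((j : ℕ) : ℝ) + 1) ^ m * q ^ j) := by
  have hs : Summable (fun j : ℕ => (((j : ℕ) : ℝ) + 1) ^ m * q ^ j) := summable_succ_pow_mul_geometric hq0 hq1 m
  have hsK : Summable (fun j : ℕ => (((K + j : ℕ) : ℝ) + 1) ^ m * q ^ (K + j)) :=
    (summable_succ_pow_mul_geometric hq0 hq1 m).comp_injective (add_right_injective K)
  rw [← tsum_mul_left]
  exact Summable.tsum_le_tsum (fun j => succ_pow_mul_geometric_add_le hq0 m K j) hsK (hs.mul_left _)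

/-- The constant `Σ_{j≥0} (j+1)^m·q^j` is at least `1` (its `j = 0` term), in particular positive. [folklore] -/
theorem one_le_tsum_succ_pow_mul_geometric {q : ℝ} (hq0 : 0 ≤ q) (hq1 : q < 1) (m : ℕ) :
    1 ≤ ∑' j : ℕ, ((((j : ℕ) : ℝ) + 1) ^ m * q ^ j) := by
  have hs : Summable (fun j : ℕ => (((j : ℕ) : ℝ) + 1) ^ m * q ^ j) := summable_succ_pow_mul_geometric hq0 hq1 m
  have h := Summable.le_tsum hs 0 (fun j _ => mul_nonneg (pow_nonneg (by positivity) _) (pow_nonneg hq0 _))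
  simpa using h

/-! ## §2 The rate face for `δ_K ≤ D·(K+1)^m·q^K`, and the spine's own remainder -/

/-- **`(K+1)^m q^K` TAIL**: if the remainders of `MatchingModConstants vol l₀ δ Z` obey `δ K ≤ D·(K+1)^m·q^K` with `0 ≤ D`,
`0 ≤ q < 1`, then `|genFun Z K t − genFunLim Z t| ≤ 2·vol·D·(K+1)^m·q^K·Σ_{j≥0} (j+1)^m q^j` on `|t| ≤ l₀` — the generating
functions approach their limit at the rate `(K+1)^m·q^K` with an explicit constant (`T4TermwiseClosure.abs_genFun_sub_lim_le_of_le`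
+ §1). [folklore] -/
theorem abs_genFun_sub_lim_le_of_succ_pow_mul_geometric {vol l₀ D q : ℝ} {m : ℕ} {δ : ℕ → ℝ} {Z : ℕ → ℝ → ℝ}
    (h : MatchingModConstants vol l₀ δ Z) (hvol : 0 < vol) (hl₀ : 0 ≤ l₀) (hD : 0 ≤ D) (hq0 : 0 ≤ q) (hq1 : q < 1)
    (hle : ∀ K, δ K ≤ D * ((((K : ℕ) : ℝ) + 1) ^ m * q ^ K)) {t : ℝ} (ht : |t| ≤ l₀) (K : ℕ) :
    |genFun Z K t - genFunLim Z t|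
      ≤ 2 * vol * (D * ((((K : ℕ) : ℝ) + 1) ^ m * q ^ K) * ∑' j : ℕ, ((((j : ℕ) : ℝ) + 1) ^ m * q ^ j)) := by
  have hd : Summable (fun K : ℕ => D * ((((K : ℕ) : ℝ) + 1) ^ m * q ^ K)) :=
    (summable_succ_pow_mul_geometric hq0 hq1 m).mul_left D
  refine (abs_genFun_sub_lim_le_of_le h hvol hl₀ hle hd ht K).trans ?_
  have htail : ∑' j : ℕ, D * ((((K + j : ℕ) : ℝ) + 1) ^ m * q ^ (K + j))
      ≤ D * (((((K : ℕ) : ℝ) + 1) ^ m * q ^ K) * ∑' j : ℕ, ((((j : ℕ) : ℝ) + 1) ^ m * q ^ j)) := by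
    rw [tsum_mul_left]
    exact mul_le_mul_of_nonneg_left (tsum_tail_succ_pow_mul_geometric_le hq0 hq1 m K) hD
  calc 2 * vol * ∑' j : ℕ, D * ((((K + j : ℕ) : ℝ) + 1) ^ m * q ^ (K + j))
      ≤ 2 * vol * (D * (((((K : ℕ) : ℝ) + 1) ^ m * q ^ K) * ∑' j : ℕ, ((((j : ℕ) : ℝ) + 1) ^ m * q ^ j))) :=
        mul_le_mul_of_nonneg_left htail (by positivity)
    _ = 2 * vol * (D * ((((K : ℕ) : ℝ) + 1) ^ m * q ^ K) * ∑' j : ℕ, ((((j : ℕ) : ℝ) + 1) ^ m * q ^ j)) := by ring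

/-- **THE SPINE'S OWN REMAINDER ⟹ ITS RATE OF APPROACH.**  If the consecutive dressed partition functions match modulo constants
with the spine's transported total as remainder, `MatchingModConstants vol l₀ (delta E ρ inj) Z`, under an injected rate
`InjectedRate C c θ inj` with `0 ≤ θ < 1`, contraction `0 ≤ ρ < 1` and `0 ≤ E` (the data of `T4CauchySum.delta_le` ∕
`summable_delta`), then, uniformly on `|t| ≤ l₀`,
`|genFun Z K t − genFunLim Z t| ≤ 2·vol·E·C·(K+1)^{c+1}·max(θ,ρ)^K·Σ_{j≥0} (j+1)^{c+1} max(θ,ρ)^j` — the rate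
`(K+1)^{c+1}·max(θ,ρ)^K` of census R71's dictionary, now BY NAME. [bookkeeping] -/
theorem abs_genFun_sub_lim_le_of_injectedRate {vol l₀ C θ E ρ : ℝ} {c : ℕ} {inj : ℕ → ℕ → ℝ} {Z : ℕ → ℝ → ℝ}
    (h : MatchingModConstants vol l₀ (delta E ρ inj) Z) (hinj : InjectedRate C c θ inj) (hE : 0 ≤ E)
    (hθ : 0 ≤ θ) (hθ1 : θ < 1) (hρ : 0 ≤ ρ) (hρ1 : ρ < 1) (hvol : 0 < vol) (hl₀ : 0 ≤ l₀) {t : ℝ} (ht : |t| ≤ l₀)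
    (K : ℕ) :
    |genFun Z K t - genFunLim Z t|
      ≤ 2 * vol * (E * C * ((((K : ℕ) : ℝ) + 1) ^ (c + 1) * (max θ ρ) ^ K) *
          ∑' j : ℕ, ((((j : ℕ) : ℝ) + 1) ^ (c + 1) * (max θ ρ) ^ j)) := by
  have hq0 : 0 ≤ max θ ρ := hθ.trans (le_max_left θ ρ)
  have hq1 : max θ ρ < 1 := max_lt hθ1 hρ1
  have hC : 0 ≤ C := by simpa using hinj.const_nonneg 0
  have hle : ∀ K : ℕ, delta E ρ inj K ≤ E * C * ((((K : ℕ) : ℝ) + 1) ^ (c + 1) * (max θ ρ) ^ K) := fun K =>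
    (delta_le hinj hE hθ hρ K).trans_eq (by ring)
  exact abs_genFun_sub_lim_le_of_succ_pow_mul_geometric h hvol hl₀ (mul_nonneg hE hC) hq0 hq1 hle ht K

/-! ## §3 Dictionary: geometric in the number of steps `K` = a power law in the lattice spacing `a_K = (L^K)⁻¹` -/

/-- **`r^K = a_K^{β′}`** with `a_K = (L^K)⁻¹` the lattice spacing of the run with `K` steps and `β′ = log_L(1∕r)`: for `1 < L`
and `0 < r`, `r ^ K = ((L ^ K)⁻¹) ^ (Real.logb L r⁻¹)` (real power).  So a rate `(K+1)^m·r^K` in the number of steps is the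
power law `a^{β′}` in the spacing up to the logarithmic factor `(K+1)^m = (1 + log_L(1∕a_K))^m`. [folklore] -/
theorem pow_eq_spacing_rpow {L r : ℝ} (hL : 1 < L) (hr : 0 < r) (K : ℕ) :
    r ^ K = ((L ^ K)⁻¹) ^ (Real.logb L r⁻¹) := by
  have hL0 : 0 < L := zero_lt_one.trans hL
  have hlogL : Real.log L ≠ 0 := Real.log_ne_zero_of_pos_of_ne_one hL0 hL.ne'
  have haK : 0 < (L ^ K)⁻¹ := inv_pos.mpr (pow_pos hL0 K)
  rw [← Real.rpow_natCast r K, Real.rpow_def_of_pos hr, Real.rpow_def_of_pos haK]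
  congr 1
  rw [Real.log_inv, Real.log_pow, Real.logb, Real.log_inv]
  field_simp

/-- The exponent `β′ = log_L(1∕r)` is POSITIVE when `r < 1` … [folklore] -/
theorem spacing_exponent_pos {L r : ℝ} (hL : 1 < L) (hr : 0 < r) (hr1 : r < 1) : 0 < Real.logb L r⁻¹ :=
  Real.logb_pos hL (one_lt_inv_iff₀.mpr ⟨hr, hr1⟩)

/-- … and BELOW ONE exactly when `L⁻¹ < r` — e.g. for the spine's `r = max(θ,ρ) ≥ ρ = L^{−β}` with `β < 1`: the predicted rate is
a power `a^{β′}` of the spacing with `β′ < 1`, weaker than (and consistent with) the MODEL observation O(a)∕O(a²) of census R71;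
no optimality is claimed anywhere. [folklore] -/
theorem spacing_exponent_lt_one {L r : ℝ} (hL : 1 < L) (hr : 0 < r) (hLr : L⁻¹ < r) : Real.logb L r⁻¹ < 1 := by
  have hL0 : 0 < L := zero_lt_one.trans hL
  have h : r⁻¹ < L := (inv_lt_comm₀ hr hL0).mpr hLr
  calc Real.logb L r⁻¹ < Real.logb L L := (Real.logb_lt_logb_iff hL (inv_pos.mpr hr) hL0).mpr h
    _ = 1 := Real.logb_self_eq_one hL

/-- The contraction `ρ = L^{−β}` with `0 ≤ β < 1` (the (2.43) exponent) satisfies `L⁻¹ < ρ < 1` when `0 < β`, and `L⁻¹ < ρ` in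
any case — so `max(θ,ρ) > L⁻¹` and `spacing_exponent_lt_one` applies to the spine's rate. [folklore] -/
theorem inv_lt_rpow_neg_of_lt_one {L β : ℝ} (hL : 1 < L) (hβ1 : β < 1) : L⁻¹ < L ^ (-β) := by
  have hL0 : 0 < L := zero_lt_one.trans hL
  rw [← Real.rpow_neg_one L]
  exact Real.rpow_lt_rpow_of_exponent_lt hL (by linarith)

end Summit.QuantumFields.BalabanUV.T4Continuum.Spine.NE7

end
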